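import Summits.QuantumFields.YangMills.Theorems.SwapVirialDeficitBlowUpGnomonicFollowersWeight
import HarnessLib

/-!
# The leaders' Euler weight against the deficit: explicit HUB STIFFNESS (the valley term made pointwise)

The residue (C1) of the virial route (memo3) is the LEADERS' window inequality `K_L(½⟪W_L⟫₀ − β⟪R⟫₀) ≤ (1/2 − c)Z₀` (hypothesis of
✓`principalStiffness_of_leadersWindow`), `W_L = gnoWtr(η_x) + gnoWtr(η_y) + gnomonicW(η_z)`.  This file makes the VALLEY structure of `W_L` pointwise and
explicit: against the deficit, the three leader letters have stiffness `sin²2ψ`, `sin²ψ`, `1` respectively (`ψ` the hub angle, `sin ψ = ‖Im a‖/‖a‖`),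
with polynomial constants — the quantitative form of fcl-p3 g46's "k = 2" count (ym-idea-1 STATUS 14:36Z ∕ 14:39Z):

* §1 quaternion algebra: ★ `norm_sq_axial_commutator` (`‖Aq − qA‖² = 4A_I²(q_J² + q_K²)` for axial `A`), `sq_axial_components`, ★ `gnoWtr_eq_four_mul`
  (`gnoWtr(v) = 4(q_J² + q_K²)`, `q` the unit letter), `hubUnit_axial` (`A = radialUnit (axisPoint a)`: `A_J = A_K = 0`, `A_I = ‖Im a‖/‖a‖`);
* §3 (principal sector, `a ≠ 0`, from ✓`chartBox_of_chartDeficit`'s σ-relations `‖c·C_{σμ} − C_μ·c‖_F ≤ 60L³√F̂`):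
  ★★ `hubStiff_mul_gnoWtr_y_le` — `(‖Im a‖/‖a‖)²·gnoWtr(η_y) ≤ 1800·L⁶·F̂` (`μ = 2`: `[c, C₂]`);
  ★★ `gnomonicW_z_le` — `gnomonicW(η_z) ≤ 7200·L⁶·F̂` (`μ = 0`: `A(Āx̂Aẑ) − x̂A = x̂A(ẑ − 1)`; no hub factor);
  ★★ `hubStiff_mul_gnoWtr_x_le` — `(2·(Re a/‖a‖)(‖Im a‖/‖a‖))²·gnoWtr(η_x) ≤ 7200·L⁶·F̂` (`μ = 0, 1`: `[c², C₀]` via `A²x̂ − x̂A² = A(Ax̂ − q₁A) + (Aq₁ − x̂A)A`);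
  ★★★ `leadersW_hubStiff_le` — the sum: `sin²2ψ·W(x) + sin²ψ·W(y) + W(z) ≤ 16200·L⁶·F̂`.
So `½K_L⟪W_L⟫₀` is controlled by the HUB-WEIGHTED mean deficit `⟪F̂·(sin⁻²2ψ + sin⁻²ψ + 1)⟫₀`, polynomially in `L`; the remaining (C1) question is the
size of that hub-weighted mean on the window (heuristically `O(poly(L)/√β)·Z₀` from the flat-in-`ψ` soft law — NOT proved here).

HONEST LABEL: three pointwise inequalities at fixed `L` (bookkeeping toward the valley term of a DRAFT line); no estimate on ⟨24197⟩ (window-uniform, OPEN);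
⟨24194⟩ ∕ ⟨24497⟩ OPEN; own crux ⟨22884⟩ OPEN (blocked-on ⟨19935⟩); no crux, rung of record or summit is proved; the Yang–Mills mass gap is NOT proved; no summit
is proved by a line.  THEOREMS ONLY (0 `def`, 0 `sorry`; two `private` algebra helpers), standard axioms.  Width seat ym-line-sfw-p2-w2 g57 (cell ym-idea-1,
free hands), `--supports stmt-QuantumFields-24197`.  References: [cite: Luscher1983, §2]; [cite: tHooft1979]; [cite: MontvayMunster1994, §3.2.3]; [folklore].
-/

set_option autoImplicit false
set_option synthInstance.maxSize 1024

noncomputable section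

open MeasureTheory Quaternion Set
open scoped Quaternion ENNReal BigOperators RealInnerProductSpace
open Literature.MathematicalPhysics.QuantumLattice
open Literature.MathematicalPhysics.QuantumFieldTheory hiding SU2 su2Quat_mul
open Summit.QuantumFields.YangMills.Theorems.SwapTwistDeficit.ToronLog

namespace Summit.QuantumFields.YangMills.Theorems.SwapVirialDeficit.BlowUpRing

open Literature.Analysis.Calculus (radialUnit radialUnit_def norm_radialUnit)
open Summit.QuantumFields.YangMills.Theorems.FemtoTransferGap
open Summit.QuantumFields.YangMills.Theorems.FemtoTransferGap.TT
open Summit.QuantumFields.YangMills.Theorems.VirialFluxGap.RingDeficit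
open Summit.QuantumFields.YangMills.Theorems.SwapVirialDeficit.SwapRing
open Summit.QuantumFields.YangMills.Theorems.SwapVirialDeficit.ZeroModeSigma (su2Quat_quatToSU2_eq_radialUnit radialUnit_mul_left slaveP slaveP_def
  norm_slaveP norm_axisUnit dilateIm)
open Summit.QuantumFields.YangMills.Theorems.SwapVirialDeficit.BlowUp (leaderTuple leaderTuple_apply dilateIm_one_apply)
open Summit.QuantumFields.YangMills.Theorems.SwapVirialDeficit.Gnomonic (gnomonicW normSq3 normSq3_nonneg gnomonicW_nonneg_le
  su2Quat_quatToSU2_smul_gnomonicQuat inner_one_right abs_gnoSign su2Quat_quatToSU2_slaveP_mul su2Quat_quatToSU2_axisUnit)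
open Summit.QuantumFields.YangMills.Theorems.SwapTwistDeficit.PeriodicRingFloor (frobNorm_sub_eq_sqrt_two_mul_norm_su2Quat_sub)
open Literature.MathematicalPhysics.QuantumFieldTheory.Balaban1983to89.T4HaarSU2Translate (su2Quat_mul)

variable {L : ℕ} [NeZero L]

/-! ## §1 Quaternion algebra: commutators with an axial unit see exactly the transverse components -/

/-- `‖q‖² = re² + imI² + imJ² + imK²`. [folklore] -/
private theorem norm_sq_eq_components (q : ℍ) : ‖q‖ ^ 2 = q.re ^ 2 + q.imI ^ 2 + q.imJ ^ 2 + q.imK ^ 2 := by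
  rw [sq, ← Quaternion.normSq_eq_norm_mul_self, Quaternion.normSq_def']

omit [NeZero L] in
/-- ★ For an AXIAL quaternion `A = (a₀, a₁, 0, 0)` and any `q`: `‖Aq − qA‖² = 4a₁²(q_J² + q_K²)` — the commutator with the hub sees exactly the transverse
(`J, K`) components, with stiffness `a₁² = sin²ψ`. [folklore] -/
theorem norm_sq_axial_commutator {A q : ℍ} (hJ : A.imJ = 0) (hK : A.imK = 0) :
    ‖A * q - q * A‖ ^ 2 = 4 * A.imI ^ 2 * (q.imJ ^ 2 + q.imK ^ 2) := by
  rw [norm_sq_eq_components]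
  simp only [Quaternion.re_sub, Quaternion.imI_sub, Quaternion.imJ_sub, Quaternion.imK_sub, Quaternion.re_mul, Quaternion.imI_mul,
    Quaternion.imJ_mul, Quaternion.imK_mul, hJ, hK]
  ring

omit [NeZero L] in
/-- The square of an axial quaternion is axial: `(A²).imJ = (A²).imK = 0`, `(A²).imI = 2a₀a₁`. [folklore] -/
theorem sq_axial_components {A : ℍ} (hJ : A.imJ = 0) (hK : A.imK = 0) :
    (A * A).imJ = 0 ∧ (A * A).imK = 0 ∧ (A * A).imI = 2 * A.re * A.imI := by
  refine ⟨?_, ?_, ?_⟩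
  · rw [Quaternion.imJ_mul, hJ, hK]; ring
  · rw [Quaternion.imK_mul, hJ, hK]; ring
  · rw [Quaternion.imI_mul, hJ, hK]; ring

omit [NeZero L] in
/-- ★ THE TRANSVERSE WEIGHT IS A FUNCTION OF THE UNIT LETTER: `gnoWtr(v) = 4(q_J² + q_K²)` for `q = su2Quat (quatToSU2 (gnoLetter ε v))`. [folklore] -/
theorem gnoWtr_eq_four_mul (ε : Bool) (v : Fin 3 → ℝ) :
    gnoWtr v = 4 * ((su2Quat (quatToSU2 (gnoLetter ε v))).imJ ^ 2 + (su2Quat (quatToSU2 (gnoLetter ε v))).imK ^ 2) := by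
  rw [gnoLetter_eq, su2Quat_quatToSU2_smul_gnomonicQuat (abs_gnoSign ε), radialUnit_def, smul_smul]
  simp only [Quaternion.imJ_smul, Quaternion.imK_smul, smul_eq_mul]
  have hq : ‖gnomonicQuat v‖ ^ 2 = 1 + ∑ i, v i ^ 2 := sq_norm_gnomonicQuat v
  have hJ : (gnomonicQuat v).imJ = v 1 := rfl
  have hK : (gnomonicQuat v).imK = v 2 := rfl
  rw [hJ, hK]
  have hpos : 0 < ‖gnomonicQuat v‖ := norm_gnomonicQuat_pos v
  have hs2 : gnoSign ε ^ 2 = 1 := gnoSign_sq ε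
  unfold gnoWtr
  rw [Fin.sum_univ_three] at hq
  have hne : (1 + ∑ i : Fin 3, v i ^ 2) ≠ 0 := by
    rw [Fin.sum_univ_three]; positivity
  rw [Fin.sum_univ_three]
  field_simp
  rw [hq, hs2]
  ring

/-! ## §2 The letters of the σ-leader tuple as unit quaternions -/

omit [NeZero L] in
/-- The hub unit `A = radialUnit (axisPoint a)` is AXIAL: `A.imJ = A.imK = 0`, `A.imI = ‖Im a‖/‖a‖`. [folklore] -/
theorem hubUnit_axial {a : ℍ} :
    (radialUnit (axisPoint a)).imJ = 0 ∧ (radialUnit (axisPoint a)).imK = 0 ∧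
      (radialUnit (axisPoint a)).imI = ‖a‖⁻¹ * ‖a.im‖ := by
  rw [radialUnit_def, ZeroModeGroup.norm_axisPoint]
  refine ⟨?_, ?_, ?_⟩ <;> simp [axisPoint]

/-! ## §3 The leaders' weights against the deficit, with explicit hub stiffness (principal sector) -/

/-- ★★ **THE `y`-LETTER**: `(‖a.im‖/‖a‖)²·gnoWtr(η_y) ≤ 1800·L⁶·F̂` — from the σ-relation `‖c·C₂ − C₂·c‖_F ≤ 60L³√F̂` (✓`chartBox_of_chartDeficit`, `μ = 2`):
the transverse part of `y` is stiff with constant `sin²ψ = ‖Im a‖²/‖a‖²` (the hub angle). [cite: Luscher1983, §2] [cite: tHooft1979] -/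
theorem hubStiff_mul_gnoWtr_y_le {a : ℍ} (ha : a ≠ 0) (ε : GnoSign L) (η : GnoCoord L) :
    (‖a‖⁻¹ * ‖a.im‖) ^ 2 * gnoWtr η.1.2 ≤ 1800 * (L : ℝ) ^ 6 * chartDeficit L (fun _ => false) (fun _ => 1) (blowUpPoint 1 (gnomonicPoint a ε η)) := by
  obtain ⟨-, hσ, -⟩ := chartBox_of_chartDeficit (blowUpPoint (L := L) 1 (gnomonicPoint a ε η))
  have hF0 := chartDeficit_nonneg (fun _ => false) (fun _ => (1 : SU2)) (blowUpPoint (L := L) 1 (gnomonicPoint a ε η))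
  have h := hσ 2
  -- the leaders at `t = 1`
  have eC : (blowUpPoint (L := L) 1 (gnomonicPoint a ε η)).1 = leaderTuple a ((gnoLetter ε.1.1 η.1.1, gnoLetter ε.1.2 η.1.2), gnoLetter ε.2.1 η.2.1) := by
    rw [blowUpPoint_one_gnomonicPoint]
  rw [eC] at h
  have hswap : Equiv.swap (0 : Fin 3) 1 2 = 2 := by decide
  rw [hswap] at h
  obtain ⟨-, -, h2, h3⟩ := leaderTuple_apply a ((gnoLetter ε.1.1 η.1.1, gnoLetter ε.1.2 η.1.2), gnoLetter ε.2.1 η.2.1)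
  rw [show (Fin.castSucc (2 : Fin 3) : Fin 4) = 2 from rfl, show (Fin.last 3 : Fin 4) = 3 from rfl, h2, h3] at h
  -- to quaternions
  rw [frobNorm_sub_eq_sqrt_two_mul_norm_su2Quat_sub, su2Quat_mul, su2Quat_mul, su2Quat_quatToSU2_axisUnit ha,
    su2Quat_quatToSU2_eq_radialUnit (gnoLetter_ne_zero _ _)] at h
  -- `‖Aŷ − ŷA‖² = 4 sin²ψ (ŷ_J² + ŷ_K²) = sin²ψ · gnoWtr`
  obtain ⟨hJ, hK, hI⟩ := hubUnit_axial (a := a)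
  have hcomm := norm_sq_axial_commutator (q := radialUnit (gnoLetter ε.1.2 η.1.2)) hJ hK
  have hW := gnoWtr_eq_four_mul ε.1.2 η.1.2
  rw [su2Quat_quatToSU2_eq_radialUnit (gnoLetter_ne_zero _ _)] at hW
  rw [hI] at hcomm
  have hn : 0 ≤ ‖radialUnit (axisPoint a) * radialUnit (gnoLetter ε.1.2 η.1.2) - radialUnit (gnoLetter ε.1.2 η.1.2) * radialUnit (axisPoint a)‖ := norm_nonneg _
  have hsq : (Real.sqrt 2 * ‖radialUnit (axisPoint a) * radialUnit (gnoLetter ε.1.2 η.1.2) - radialUnit (gnoLetter ε.1.2 η.1.2) * radialUnit (axisPoint a)‖) ^ 2 ≤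
      (60 * (L : ℝ) ^ 3 * Real.sqrt (chartDeficit L (fun _ => false) (fun _ => 1) (blowUpPoint 1 (gnomonicPoint a ε η)))) ^ 2 :=
    pow_le_pow_left₀ (by positivity) h 2
  rw [mul_pow, mul_pow, Real.sq_sqrt (by norm_num : (0:ℝ) ≤ 2), Real.sq_sqrt hF0, hcomm] at hsq
  rw [hW]
  nlinarith [hsq]

/-- For a unit quaternion `A`: `A · Ā = 1`. [folklore] -/
private theorem mul_star_of_norm_one {A : ℍ} (hA : ‖A‖ = 1) : A * star A = 1 := by
  rw [Quaternion.self_mul_star, Quaternion.normSq_eq_norm_mul_self, hA, mul_one, Quaternion.coe_one]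

/-- ★★ **THE `z`-LETTER** (slaved): `gnomonicW(η_z) ≤ 7200·L⁶·F̂` — from `‖c·C₁ − C₀·c‖_F ≤ 60L³√F̂` (`μ = 0`): `A(Āx̂Aẑ) − x̂A = x̂A(ẑ − 1)`, so
`‖ẑ − 1‖ ≤ 60L³√F̂/√2`; FULL stiffness, no hub factor. [cite: Luscher1983, §2] [cite: tHooft1979] -/
theorem gnomonicW_z_le {a : ℍ} (ha : a ≠ 0) (ε : GnoSign L) (η : GnoCoord L) :
    gnomonicW η.2.1 ≤ 7200 * (L : ℝ) ^ 6 * chartDeficit L (fun _ => false) (fun _ => 1) (blowUpPoint 1 (gnomonicPoint a ε η)) := by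
  obtain ⟨-, hσ, -⟩ := chartBox_of_chartDeficit (blowUpPoint (L := L) 1 (gnomonicPoint a ε η))
  have hF0 := chartDeficit_nonneg (fun _ => false) (fun _ => (1 : SU2)) (blowUpPoint (L := L) 1 (gnomonicPoint a ε η))
  have h := hσ 0
  have eC : (blowUpPoint (L := L) 1 (gnomonicPoint a ε η)).1 = leaderTuple a ((gnoLetter ε.1.1 η.1.1, gnoLetter ε.1.2 η.1.2), gnoLetter ε.2.1 η.2.1) := by
    rw [blowUpPoint_one_gnomonicPoint]
  rw [eC] at h
  have hswap : Equiv.swap (0 : Fin 3) 1 0 = 1 := by decide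
  rw [hswap] at h
  obtain ⟨h0, h1, -, h3⟩ := leaderTuple_apply a ((gnoLetter ε.1.1 η.1.1, gnoLetter ε.1.2 η.1.2), gnoLetter ε.2.1 η.2.1)
  rw [show (Fin.castSucc (1 : Fin 3) : Fin 4) = 1 from rfl, show (Fin.castSucc (0 : Fin 3) : Fin 4) = 0 from rfl, show (Fin.last 3 : Fin 4) = 3 from rfl,
    h0, h1, h3] at h
  have hA1 : ‖radialUnit (axisPoint a)‖ = 1 := norm_axisUnit ha
  rw [frobNorm_sub_eq_sqrt_two_mul_norm_su2Quat_sub, su2Quat_mul, su2Quat_mul, su2Quat_quatToSU2_axisUnit ha,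
    su2Quat_quatToSU2_eq_radialUnit (gnoLetter_ne_zero _ _), su2Quat_quatToSU2_slaveP_mul hA1 (gnoLetter_ne_zero _ _) (gnoLetter_ne_zero _ _),
    su2Quat_quatToSU2_eq_radialUnit (gnoLetter_ne_zero _ _), su2Quat_quatToSU2_eq_radialUnit (gnoLetter_ne_zero _ _)] at h
  -- `A (Ā x̂ A ẑ) − x̂ A = x̂ A (ẑ − 1)`
  have hx1 : ‖radialUnit (gnoLetter ε.1.1 η.1.1)‖ = 1 := norm_radialUnit (gnoLetter_ne_zero _ _)
  have hz1 : ‖radialUnit (gnoLetter ε.2.1 η.2.1)‖ = 1 := norm_radialUnit (gnoLetter_ne_zero _ _)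
  have e : radialUnit (axisPoint a) * (star (radialUnit (axisPoint a)) * radialUnit (gnoLetter ε.1.1 η.1.1) * radialUnit (axisPoint a) *
        radialUnit (gnoLetter ε.2.1 η.2.1)) - radialUnit (gnoLetter ε.1.1 η.1.1) * radialUnit (axisPoint a) =
      radialUnit (gnoLetter ε.1.1 η.1.1) * radialUnit (axisPoint a) * (radialUnit (gnoLetter ε.2.1 η.2.1) - 1) := by
    have hAA := mul_star_of_norm_one hA1
    calc _ = (radialUnit (axisPoint a) * star (radialUnit (axisPoint a))) * radialUnit (gnoLetter ε.1.1 η.1.1) * radialUnit (axisPoint a) *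
          radialUnit (gnoLetter ε.2.1 η.2.1) - radialUnit (gnoLetter ε.1.1 η.1.1) * radialUnit (axisPoint a) := by noncomm_ring
      _ = _ := by rw [hAA]; noncomm_ring
  rw [e, norm_mul, norm_mul, hx1, hA1, one_mul, one_mul] at h
  -- `gnomonicW = 4(1 − Re ẑ²) ≤ 4‖ẑ − 1‖² ≤ 4 · 1800 L⁶ F̂`
  have hW := gnomonicW_eq_four_mul ε.2.1 η.2.1
  rw [su2Quat_quatToSU2_eq_radialUnit (gnoLetter_ne_zero _ _)] at hW
  have h4 := four_mul_one_sub_re_sq_le hz1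
  have hsq : (Real.sqrt 2 * ‖radialUnit (gnoLetter ε.2.1 η.2.1) - 1‖) ^ 2 ≤
      (60 * (L : ℝ) ^ 3 * Real.sqrt (chartDeficit L (fun _ => false) (fun _ => 1) (blowUpPoint 1 (gnomonicPoint a ε η)))) ^ 2 :=
    pow_le_pow_left₀ (by positivity) h 2
  rw [mul_pow, mul_pow, Real.sq_sqrt (by norm_num : (0:ℝ) ≤ 2), Real.sq_sqrt hF0] at hsq
  rw [hW]
  nlinarith [hsq, h4]

/-- ★★ **THE `x`-LETTER**: `(2·(a.re/‖a‖)·(‖a.im‖/‖a‖))²·gnoWtr(η_x) ≤ 7200·L⁶·F̂` — from the two σ-relations `μ = 0, 1`: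
`A²x̂ − x̂A² = A(Ax̂ − q₁A) + (Aq₁ − x̂A)A`, and `‖A²x̂ − x̂A²‖² = 4·(2A₀A₁)²·(x̂_J² + x̂_K²)`; stiffness `sin²(2ψ)`. [cite: Luscher1983, §2] [cite: tHooft1979] -/
theorem hubStiff_mul_gnoWtr_x_le {a : ℍ} (ha : a ≠ 0) (ε : GnoSign L) (η : GnoCoord L) :
    (2 * (‖a‖⁻¹ * a.re) * (‖a‖⁻¹ * ‖a.im‖)) ^ 2 * gnoWtr η.1.1 ≤
      7200 * (L : ℝ) ^ 6 * chartDeficit L (fun _ => false) (fun _ => 1) (blowUpPoint 1 (gnomonicPoint a ε η)) := by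
  obtain ⟨-, hσ, -⟩ := chartBox_of_chartDeficit (blowUpPoint (L := L) 1 (gnomonicPoint a ε η))
  have hF0 := chartDeficit_nonneg (fun _ => false) (fun _ => (1 : SU2)) (blowUpPoint (L := L) 1 (gnomonicPoint a ε η))
  have hμ0 := hσ 0
  have hμ1 := hσ 1
  have eC : (blowUpPoint (L := L) 1 (gnomonicPoint a ε η)).1 = leaderTuple a ((gnoLetter ε.1.1 η.1.1, gnoLetter ε.1.2 η.1.2), gnoLetter ε.2.1 η.2.1) := by
    rw [blowUpPoint_one_gnomonicPoint]
  rw [eC] at hμ0 hμ1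
  have hswap0 : Equiv.swap (0 : Fin 3) 1 0 = 1 := by decide
  have hswap1 : Equiv.swap (0 : Fin 3) 1 1 = 0 := by decide
  rw [hswap0] at hμ0
  rw [hswap1] at hμ1
  obtain ⟨h0, h1, -, h3⟩ := leaderTuple_apply a ((gnoLetter ε.1.1 η.1.1, gnoLetter ε.1.2 η.1.2), gnoLetter ε.2.1 η.2.1)
  rw [show (Fin.castSucc (1 : Fin 3) : Fin 4) = 1 from rfl, show (Fin.castSucc (0 : Fin 3) : Fin 4) = 0 from rfl, show (Fin.last 3 : Fin 4) = 3 from rfl,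
    h0, h1, h3] at hμ0 hμ1
  have hA1 : ‖radialUnit (axisPoint a)‖ = 1 := norm_axisUnit ha
  rw [frobNorm_sub_eq_sqrt_two_mul_norm_su2Quat_sub, su2Quat_mul, su2Quat_mul, su2Quat_quatToSU2_axisUnit ha,
    su2Quat_quatToSU2_eq_radialUnit (gnoLetter_ne_zero _ _)] at hμ0 hμ1
  -- abbreviate the quaternions by generalisation
  generalize hAdef : radialUnit (axisPoint a) = A at hμ0 hμ1 hA1
  generalize hxdef : radialUnit (gnoLetter ε.1.1 η.1.1) = xh at hμ0 hμ1
  generalize hqdef : su2Quat (quatToSU2 (slaveP A (gnoLetter ε.1.1 η.1.1) * gnoLetter ε.2.1 η.2.1)) = q₁ at hμ0 hμ1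
  -- `‖A²x̂ − x̂A²‖ ≤ ‖Ax̂ − q₁A‖ + ‖Aq₁ − x̂A‖`
  have e : A * A * xh - xh * (A * A) = A * (A * xh - q₁ * A) + (A * q₁ - xh * A) * A := by noncomm_ring
  have hcomm : ‖A * A * xh - xh * (A * A)‖ ≤ ‖A * xh - q₁ * A‖ + ‖A * q₁ - xh * A‖ := by
    rw [e]
    refine (norm_add_le _ _).trans ?_
    rw [norm_mul, norm_mul, hA1, one_mul, mul_one]
  -- axial components of `A` and `A²`
  obtain ⟨hJ, hK, hI⟩ := hubUnit_axial (a := a)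
  have hRe : (radialUnit (axisPoint a)).re = ‖a‖⁻¹ * a.re := by
    rw [radialUnit_def, ZeroModeGroup.norm_axisPoint]; simp [axisPoint]
  rw [hAdef] at hJ hK hI hRe
  obtain ⟨hJ2, hK2, hI2⟩ := sq_axial_components hJ hK
  have hsqcomm := norm_sq_axial_commutator (q := xh) hJ2 hK2
  rw [hI2, hRe, hI] at hsqcomm
  have hW := gnoWtr_eq_four_mul ε.1.1 η.1.1
  rw [su2Quat_quatToSU2_eq_radialUnit (gnoLetter_ne_zero _ _), hxdef] at hW
  -- squares
  have hle : Real.sqrt 2 * ‖A * A * xh - xh * (A * A)‖ ≤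
      2 * (60 * (L : ℝ) ^ 3 * Real.sqrt (chartDeficit L (fun _ => false) (fun _ => 1) (blowUpPoint 1 (gnomonicPoint a ε η)))) := by
    have := mul_le_mul_of_nonneg_left hcomm (Real.sqrt_nonneg 2)
    rw [mul_add] at this
    linarith [hμ0, hμ1]
  have hsq : (Real.sqrt 2 * ‖A * A * xh - xh * (A * A)‖) ^ 2 ≤
      (2 * (60 * (L : ℝ) ^ 3 * Real.sqrt (chartDeficit L (fun _ => false) (fun _ => 1) (blowUpPoint 1 (gnomonicPoint a ε η))))) ^ 2 :=
    pow_le_pow_left₀ (by positivity) hle 2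
  rw [mul_pow, mul_pow, mul_pow, Real.sq_sqrt (by norm_num : (0:ℝ) ≤ 2), Real.sq_sqrt hF0, hsqcomm] at hsq
  rw [hW]
  nlinarith [hsq]

/-- ★★★ **THE LEADERS' EULER WEIGHT AGAINST THE DEFICIT, WITH EXPLICIT HUB STIFFNESS** (principal sector; `a ≠ 0`; `A₀ = a.re/‖a‖`, `A₁ = ‖Im a‖/‖a‖`,
so `A₁ = sin ψ`, `2A₀A₁ = sin 2ψ`):  `(2A₀A₁)²·gnoWtr(η_x) + A₁²·gnoWtr(η_y) + gnomonicW(η_z) ≤ 16200·L⁶·F̂`.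
The valley term `½K_L⟪W_L⟫₀` of (C1) is thus controlled by the HUB-WEIGHTED mean deficit `⟪F̂·(sin⁻²2ψ + sin⁻²ψ + 1)⟫₀`; the loss of stiffness at
`ψ → 0` (and at `ψ → π/2` for `x`, where `c² → −1` is central) is explicit and polynomial in `L`. [cite: Luscher1983, §2] [cite: tHooft1979] -/
theorem leadersW_hubStiff_le {a : ℍ} (ha : a ≠ 0) (ε : GnoSign L) (η : GnoCoord L) :
    (2 * (‖a‖⁻¹ * a.re) * (‖a‖⁻¹ * ‖a.im‖)) ^ 2 * gnoWtr η.1.1 + (‖a‖⁻¹ * ‖a.im‖) ^ 2 * gnoWtr η.1.2 + gnomonicW η.2.1 ≤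
      16200 * (L : ℝ) ^ 6 * chartDeficit L (fun _ => false) (fun _ => 1) (blowUpPoint 1 (gnomonicPoint a ε η)) := by
  have hx := hubStiff_mul_gnoWtr_x_le (L := L) ha ε η
  have hy := hubStiff_mul_gnoWtr_y_le (L := L) ha ε η
  have hz := gnomonicW_z_le (L := L) ha ε η
  linarith

end Summit.QuantumFields.YangMills.Theorems.SwapVirialDeficit.BlowUpRing

end
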